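import Summits.ABC.IUTFork.Repair.CandInternal11GapLabelCutArith
import Summits.ABC.IUTFork.Repair.EvalHonestCeiling
import Literature.IUT.LogVolume.PadicSubfields
import HarnessLib

/-!
# IUT REPAIR branch → R-H ROUND 1, ROW 1 «label-cut-j2»: the k2 TEST against the UNRAMIFIED-ODD refutation family —
# the cut keeps the label `j = 2`, and `j = 2` is exactly the first label the family kills

PROOF-ONLY (0 definitions, 0 `Prop` facts, no instance, no notation; abc-iut cell, rung LADDER-ABC:A2.RESCUE.H; seat abc-iut-rh-tst-1 =
R-H ROUND 1 PAIR n = 1 TESTER, director-abc W13 (A) item k2). ROW 1 of `plan/rescue/R-H/RH-CANDIDATES.tsv` v1 (sha16 f7773e15cd7f6906),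
informal statement VERBATIM: «I06⋆ cells at labels j ≤ 2 only: ∀ bad w: h(w,2) = 3H/(2l) ≤ κ⁻(w) (POS door) — no claim at j ≥ 3», scope
«all bad places, all admissible l». The «unramified-odd refutation family» = the landed Negative lemmas that killed RP-I06⋆ as typed:
`CandInternal2Real.not_mem_jsq_smul_logShell_of_unramified` (element), the `κ⁻/κ⁺` column arithmetic of `CandInternal2RealLabels` /
`CandInternal2RealStrata` / `CandInternal11GapLabelCutArith` (column), `EvalHonestCeiling.x04_false_of_honest` / `i06_false_of_honest` (region).

FINDING (every clause a theorem below, all one-line instances BY NAME of landed lemmas):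
* §1 ELEMENT: at every unramified odd datum (`K ⊇ ℚ_p` complete, `p ≠ 2`, `e(K/ℚ_p) = 1`, `q̲` a nonzero non-unit) the `j = 2` cell
  `q̲ ∈ q̲^{2²}·ℐ_K` is FALSE (`cellTwo_false_of_unramified`) — the family lemma's hypothesis is literally `2 ≤ j`, and the cut keeps `j = 2`;
  hence the «labels ≤ 2» predicate is false there (`labelsLeTwo_false_of_unramified`), for every `l` and every local height.
* §2 COLUMN: at `e = 1`, `p` odd: `a_1 = 1`, `b_1 = −1`, so `κ⁻ = c − a_1 = 0 = b_1 + c = κ⁺` (`kappaMinus_eq_zero_of_unramified_odd`,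
  `kappaPlus_eq_zero_of_unramified_odd`); the POS door `3H ≤ 2l·κ⁻` is shut AND the NEG door `3H > 2l·κ⁺` fires at `j = 2` for every `H > 0`,
  every `l` (`posDoor_cellTwo_false_…`, `negDoor_cellTwo_…`); both label cuts equal `⌊√1⌋ = 1 < 2` (`lowerCut_eq_one_…`, `upperCut_eq_one_…`).
  Table witness: I06STAR-COLUMNS v1 row `concrete:Cor312LicenceSharpRat@p7.j2` NEG (rw_row S-RAT) = `padicSeven_cellTwo_false` below.
* §3 RIDER `p = 3` (any ramification): `a_e = 1` for every `e` (`CandInternal2RealLabels.logRadiusA_three`), so `κ⁻ ≡ 0` over `3` and the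
  POS-DOOR FORM of row 1 («h(w,2) ≤ κ⁻(w)») is false at EVERY 3-adic bad place, ramified or not (`posDoor_false_at_three`) — the data cell itself
  may still hold there by the sharp radius (`CandInternal2RealStrata.mem_pow_smul_logShell_of_height_lt_sharp`, `a > 1/(p−1)`), so this rider
  bites the FORM, not the cell.
* §4 REGION: the honest-ceiling lemmas read ONE label only: at any single label `j = i+1 ≥ 2` — in particular `j = 2` (`i = 1`, needs `l⋇ ≥ 2`)
  — the one-cell inclusions `qRegion ⊆ thetaRegion3` (X04a-cell) and `ρ(qK) ⊆ ⋃ₘ ρ(Ψₘ·𝓘)` (I06⋆-cell, under `QPinned` + RP-I05b `HInd3Theta`)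
  are FALSE on the honest bed (monotone log-volume, admissible Θ-region, exact `j²`-scaling and negative q-volume at that label):
  `cell_qRegion_subset_false_of_honest`, `cell_shellOrbit_false_of_honest`, `labelTwo_shellOrbit_false_of_honest`. Cutting the labels
  `j ≥ 3` does not evade the honest ceiling.
SCOPE REMARK (not a theorem here): for GENUINE initial Θ-data the unramified-odd stratum is empty ([IUTchI] Def. 3.1 (c): `l ∤ ord_v(q_v)` ⇒
`l | e_w`; R-W README «LOCAL-TYPE», not yet a tree lemma), so at genuine data §1–§2 cannot be instantiated (hypothesis `absRamificationIdx p K = 1`)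
and §4 needs the exact-`j²` (zero-inflation) bed; the registered scope «all bad places» and the round-1 table of record (S-RAT rows, `e_w = 1`)
do contain the stratum.

HONEST SCOPE. Classical `p`-adic analysis at one local field, real arithmetic, and three-line volume bookkeeping; nothing here asserts or refutes
abc, takes a side on [IUTchIII] Cor. 3.12 or on any author; row 1 is a HYPOTHESIS under test; typed ≠ proved; tested ≠ endorsed.
[cite: MochizukiAbsTopIII2015, Def 5.4 (iii) p. 126] [claim: Mochizuki2012, status: disputed] for the [IUTchIV] Prop. 1.2 exponents and every
IUT locution. Axioms: standard (propext, Classical.choice, Quot.sound).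
-/

noncomputable section

namespace Summit.ABC.IUTFork.Repair.RHLabelCutJ2K2

open Set Metric
open scoped Pointwise
open Literature.AnabelianGeometry.AbsoluteAnabelian Literature.IUT.LogThetaLattice Literature.IUT.LogVolume

/-! ## §1. Element form: the `j = 2` cell at an unramified odd datum -/

section Element

variable (p : ℕ) [Fact p.Prime]
variable (K : Type*) [NontriviallyNormedField K] [NormedAlgebra ℚ_[p] K] [IsUltrametricDist K] [ProperSpace K]

/-- **The `j = 2` I06⋆ cell is FALSE at every unramified odd datum**: `K ⊇ ℚ_p` complete with `e = 1`, `p ≠ 2`, `q̲ ≠ 0`, `‖q̲‖ < 1` ⟹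
`q̲ ∉ q̲^{2²} · ℐ_K` — `CandInternal2Real.not_mem_jsq_smul_logShell_of_unramified` at its boundary label `j := 2`.
[cite: MochizukiAbsTopIII2015, Def 5.4 (iii) p. 126] -/
theorem cellTwo_false_of_unramified (hp : p ≠ 2) (he : absRamificationIdx p K = 1) {q : K} (hq0 : q ≠ 0) (hq1 : ‖q‖ < 1) :
    q ∉ q ^ (2 ^ 2) • logShell (PadicLogOnUnits.ofUnitLog p K) :=
  CandInternal2Real.not_mem_jsq_smul_logShell_of_unramified p K hp he hq0 hq1 le_rfl

/-- **Row 1's one-place predicate «all I06⋆ cells at labels `j ≤ 2`» is FALSE at every unramified odd datum** (the `j = 2` instance).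
[cite: MochizukiAbsTopIII2015, Def 5.4 (iii) p. 126] -/
theorem labelsLeTwo_false_of_unramified (hp : p ≠ 2) (he : absRamificationIdx p K = 1) {q : K} (hq0 : q ≠ 0) (hq1 : ‖q‖ < 1) :
    ¬ ∀ j ≤ 2, q ∈ q ^ (j ^ 2) • logShell (PadicLogOnUnits.ofUnitLog p K) := fun h =>
  cellTwo_false_of_unramified p K hp he hq0 hq1 (h 2 le_rfl)

/-- The same with a variable cut `j₀ ≥ 2`: any label cut that keeps the label `2` somewhere on the unramified odd stratum is false there.
[cite: MochizukiAbsTopIII2015, Def 5.4 (iii) p. 126] -/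
theorem labelsLe_false_of_unramified (hp : p ≠ 2) (he : absRamificationIdx p K = 1) {q : K} (hq0 : q ≠ 0) (hq1 : ‖q‖ < 1)
    {j₀ : ℕ} (hj₀ : 2 ≤ j₀) :
    ¬ ∀ j ≤ j₀, q ∈ q ^ (j ^ 2) • logShell (PadicLogOnUnits.ofUnitLog p K) := fun h =>
  cellTwo_false_of_unramified p K hp he hq0 hq1 (h 2 hj₀)

/-- **The explicit datum `K = ℚ_p`, `q̲ = p`** (`p` odd): `p ∉ p^{2²} · ℐ_{ℚ_p}`. [cite: MochizukiAbsTopIII2015, Def 5.4 (iii) p. 126] -/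
theorem padic_cellTwo_false (hp : p ≠ 2) :
    (p : ℚ_[p]) ∉ (p : ℚ_[p]) ^ (2 ^ 2) • logShell (PadicLogOnUnits.ofUnitLog p ℚ_[p]) :=
  cellTwo_false_of_unramified p ℚ_[p] hp (absRamificationIdx_padic p)
    (by exact_mod_cast (Fact.out : p.Prime).ne_zero) Padic.norm_p_lt_one

end Element

/-- **The S-RAT table cell** (I06STAR-COLUMNS v1 row `concrete:Cor312LicenceSharpRat@p7.j2`, `p = 7`, `e_w = 1`, `j = 2`): `7 ∉ 7^{4} · ℐ_{ℚ_7}`.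
[cite: MochizukiAbsTopIII2015, Def 5.4 (iii) p. 126] -/
theorem padicSeven_cellTwo_false [Fact (Nat.Prime 7)] :
    ((7 : ℕ) : ℚ_[7]) ∉ ((7 : ℕ) : ℚ_[7]) ^ (2 ^ 2) • logShell (PadicLogOnUnits.ofUnitLog 7 ℚ_[7]) :=
  padic_cellTwo_false 7 (by norm_num)

/-! ## §2. Column form: `κ⁻ = κ⁺ = 0` at `e = 1`, `p` odd; both doors decide the `j = 2` cell NEG; both cuts equal `1` -/

section Column

/-- `a_1 = 1` for odd `p` (`⌈1/(p−2)⌉ = 1`; abc-iut-S1's `logRadiusA_eq` at `e = 1 ≤ p − 2`). [claim: Mochizuki2012, status: disputed] -/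
theorem logRadiusA_one_of_two_lt {p : ℕ} (hp : 2 < p) : logRadiusA p 1 = 1 := by
  have h := logRadiusA_eq hp le_rfl (by omega : 1 ≤ p - 2)
  simpa using h

/-- `b_1 = −1` for odd `p` (abc-iut-S1's `logRadiusB_eq` at `e = 1 ≤ p − 2`). [claim: Mochizuki2012, status: disputed] -/
theorem logRadiusB_one_of_two_lt {p : ℕ} (hp : 2 < p) : logRadiusB p 1 = -1 := by
  have h := logRadiusB_eq hp le_rfl (by omega : 1 ≤ p - 2)
  simpa using h

/-- **`κ⁻(w) = c − a_1 = 0`** at an unramified odd place. [cite: MochizukiAbsTopIII2015, Def 5.4 (iii) p. 126] -/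
theorem kappaMinus_eq_zero_of_unramified_odd {p : ℕ} (hp : 2 < p) :
    ((if p = 2 then 2 else 1 : ℕ) : ℝ) - logRadiusA p 1 = 0 := by
  rw [CandInternal2RealStrata.pstarExp_of_ne_two (by omega), logRadiusA_one_of_two_lt hp, sub_self]

/-- **`κ⁺(w) = b_1 + c = 0`** at an unramified odd place. [cite: MochizukiAbsTopIII2015, Def 5.4 (iii) p. 126] -/
theorem kappaPlus_eq_zero_of_unramified_odd {p : ℕ} (hp : 2 < p) :
    logRadiusB p 1 + ((if p = 2 then 2 else 1 : ℕ) : ℝ) = 0 := by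
  rw [CandInternal2RealStrata.pstarExp_of_ne_two (by omega), logRadiusB_one_of_two_lt hp, neg_add_cancel]

/-- **POS door shut at `j = 2`**: `¬ ((2²−1)·H ≤ 2l·κ⁻)` for `H > 0` (casts exactly as in `CandInternal2RealLabels.jsq_root_window`).
[cite: MochizukiAbsTopIII2015, Def 5.4 (iii) p. 126] -/
theorem posDoor_cellTwo_false_of_unramified_odd {p : ℕ} (hp : 2 < p) (l : ℕ) {H : ℝ} (hH : 0 < H) :
    ¬ ((((2 ^ 2 : ℕ) : ℝ) - 1) * H ≤ ((2 * l : ℕ) : ℝ) * (((if p = 2 then 2 else 1 : ℕ) : ℝ) - logRadiusA p 1)) := by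
  rw [kappaMinus_eq_zero_of_unramified_odd hp, mul_zero, not_le]
  have : (((2 ^ 2 : ℕ) : ℝ) - 1) = 3 := by norm_num
  rw [this]
  positivity

/-- **NEG door fires at `j = 2`**: even the NECESSARY inequality `(2²−1)·H ≤ 2l·κ⁺` fails for `H > 0`, so by `jsq_root_window`'s necessary
leg no `q̲` with `‖q̲‖^{2l} = p^{−H}` satisfies the `j = 2` cell. [cite: MochizukiAbsTopIII2015, Def 5.4 (iii) p. 126] -/
theorem negDoor_cellTwo_of_unramified_odd {p : ℕ} (hp : 2 < p) (l : ℕ) {H : ℝ} (hH : 0 < H) :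
    ¬ ((((2 ^ 2 : ℕ) : ℝ) - 1) * H ≤ ((2 * l : ℕ) : ℝ) * (logRadiusB p 1 + ((if p = 2 then 2 else 1 : ℕ) : ℝ))) := by
  rw [kappaPlus_eq_zero_of_unramified_odd hp, mul_zero, not_le]
  have : (((2 ^ 2 : ℕ) : ℝ) - 1) = 3 := by norm_num
  rw [this]
  positivity

/-- **The sufficient cut is `1`** at an unramified odd place: `⌊√(1 + 2l·κ⁻/H)⌋₊ = 1 < 2`. [folklore] -/
theorem lowerCut_eq_one_of_unramified_odd {p : ℕ} (hp : 2 < p) (l : ℕ) (H : ℝ) :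
    ⌊Real.sqrt (1 + 2 * (l : ℝ) * (((if p = 2 then 2 else 1 : ℕ) : ℝ) - logRadiusA p 1) / H)⌋₊ = 1 := by
  rw [kappaMinus_eq_zero_of_unramified_odd hp, mul_zero, zero_div, add_zero, Real.sqrt_one, Nat.floor_one]

/-- **The necessary cut is `1`** at an unramified odd place: `⌊√(1 + 2l·κ⁺/H)⌋₊ = 1 < 2` — with `CandInternal11GapLabelCutArith.le_upperCut_of_mem_pow_smul_logShell`
every label at which an I06⋆ cell can hold there is `≤ 1`. [folklore] -/
theorem upperCut_eq_one_of_unramified_odd {p : ℕ} (hp : 2 < p) (l : ℕ) (H : ℝ) :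
    ⌊Real.sqrt (1 + 2 * (l : ℝ) * (logRadiusB p 1 + ((if p = 2 then 2 else 1 : ℕ) : ℝ)) / H)⌋₊ = 1 := by
  rw [kappaPlus_eq_zero_of_unramified_odd hp, mul_zero, zero_div, add_zero, Real.sqrt_one, Nat.floor_one]

/-- The column verdict tied back to the element: at a local field with `e = 1`, `p` odd, `‖q̲‖^{2l} = p^{−H}`, `H > 0`, `l > 0`, every label `j`
whose cell holds satisfies `j ≤ 1` (necessary cut). [cite: MochizukiAbsTopIII2015, Def 5.4 (iii) p. 126] -/
theorem label_le_one_of_mem_of_unramified_odd (p : ℕ) [Fact p.Prime] (K : Type*) [NontriviallyNormedField K] [NormedAlgebra ℚ_[p] K]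
    [IsUltrametricDist K] [ProperSpace K] (hp : 2 < p) (he : absRamificationIdx p K = 1) {q : K} (hq : q ≠ 0) {l : ℕ} (hl : 0 < l)
    {H : ℝ} (hH : 0 < H) (hqN : ‖q‖ ^ (2 * l) = (p : ℝ) ^ (-H)) {j : ℕ}
    (hmem : q ∈ q ^ (j ^ 2) • logShell (PadicLogOnUnits.ofUnitLog p K)) : j ≤ 1 := by
  have hκ : 0 ≤ logRadiusB p (absRamificationIdx p K) + ((if p = 2 then 2 else 1 : ℕ) : ℝ) := by
    rw [he, kappaPlus_eq_zero_of_unramified_odd hp]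
  have h := CandInternal11GapLabelCutArith.le_upperCut_of_mem_pow_smul_logShell p K hq hl hH hqN hκ hmem
  rwa [he, upperCut_eq_one_of_unramified_odd hp] at h

end Column

/-! ## §3. Rider `p = 3`: the POS-door FORM of row 1 is false at every 3-adic place, whatever the ramification -/

section Three

/-- **`κ⁻ ≡ 0` over `3`** (`a_e = 1` for every `e ≥ 1`, abc-iut-rp-d2's `CandInternal2RealLabels.logRadiusA_three`). [claim: Mochizuki2012, status: disputed] -/
theorem kappaMinus_eq_zero_at_three {e : ℕ} (he : 1 ≤ e) :
    ((if (3 : ℕ) = 2 then 2 else 1 : ℕ) : ℝ) - logRadiusA 3 e = 0 := by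
  rw [CandInternal2RealStrata.pstarExp_of_ne_two (by norm_num), CandInternal2RealLabels.logRadiusA_three he, sub_self]

/-- **The POS door «h(w,j) ≤ κ⁻(w)» is shut at EVERY label `j ≥ 2` at every 3-adic place** (any `e ≥ 1`, any `l`, any `H > 0`): row 1 in its
registered POS-door form is false at every 3-adic bad place. (The data cell `q̲ ∈ q̲^{j²}·ℐ_K` may still hold there via the sharp radius —
this rider concerns the FORM.) [claim: Mochizuki2012, status: disputed] -/
theorem posDoor_false_at_three {e : ℕ} (he : 1 ≤ e) (l : ℕ) {H : ℝ} (hH : 0 < H) {j : ℕ} (hj : 2 ≤ j) :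
    ¬ ((((j ^ 2 : ℕ) : ℝ) - 1) * H ≤ ((2 * l : ℕ) : ℝ) * (((if (3 : ℕ) = 2 then 2 else 1 : ℕ) : ℝ) - logRadiusA 3 e)) := by
  rw [kappaMinus_eq_zero_at_three he, mul_zero, not_le]
  have h4 : (4 : ℝ) ≤ ((j ^ 2 : ℕ) : ℝ) := by
    have : 2 ^ 2 ≤ j ^ 2 := Nat.pow_le_pow_left hj 2
    exact_mod_cast this
  have : 0 < (((j ^ 2 : ℕ) : ℝ) - 1) := by linarith
  positivity

end Three

/-! ## §4. Region form: the honest ceiling is a ONE-CELL phenomenon at every label `j ≥ 2`, in particular `j = 2` -/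

section Region

open Thm311 Cor312 Cor312Vol

variable {T : ThetaIndex} (S : LatticeSituation T) (P : Cor312.Setting S.toSituation)
  (ρ : (∀ v : T.V, v ∈ T.Vbad → Set (S.L.StarPacket v)) → ∀ (j : T.Label) (vQ : T.VQ), Set (S.L.Packet j vQ))
  (qK : ∀ v : T.V, v ∈ T.Vbad → Set (S.L.StarPacket v))

/-- **X04a's ONE-CELL inclusion is false on the honest bed**: monotone log-volume, the (Ind3)-Θ-region admissible at the packet, exact
`j²`-scaling `logvol(thetaRegion3 j) = j²·qLocal j` and `qLocal j < 0` at ONE label `j = i+1 ≥ 2` ⟹ `¬ (qRegion j v_ℚ ⊆ thetaRegion3 j v_ℚ)`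
(the proof of `EvalHonestCeiling.x04_false_of_honest` reads only this one cell). [folklore] -/
theorem cell_qRegion_subset_false_of_honest (hmono : LogvolMono P) (i : Fin T.lstar) (hi : 1 ≤ (i : ℕ)) (vQ : T.VQ)
    (hθ : (S.D P.n).Adm _ vQ (P.thetaRegion3 (Setting.labelSucc i) vQ))
    (hscaled : (S.D P.n).logvol _ vQ (P.thetaRegion3 (Setting.labelSucc i) vQ) =
      (((i : ℕ) + 1 : ℕ) : ℝ) ^ 2 * P.qLocal (Setting.labelSucc i) vQ)
    (hneg : P.qLocal (Setting.labelSucc i) vQ < 0) :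
    ¬ (P.qRegion (Setting.labelSucc i) vQ ⊆ P.thetaRegion3 (Setting.labelSucc i) vQ) := fun h => by
  have h1 := hmono i vQ (P.hul_adm _ vQ _ (P.qRegion_mem _ vQ)) hθ h
  rw [hscaled] at h1
  exact EvalHonestCeiling.not_le_jsq_mul_of_neg hneg hi h1

/-- **I06⋆'s ONE-CELL inclusion is false on the honest bed under the q-pin and RP-I05b**: with `QPinned` and `HInd3Theta`, the single cell
`ρ(qK) j v_ℚ ⊆ ⋃ₘ ρ(Ψₘ·𝓘) j v_ℚ` at ONE label `j = i+1 ≥ 2` gives the X04a cell there, excluded by `cell_qRegion_subset_false_of_honest`.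
[folklore] -/
theorem cell_shellOrbit_false_of_honest (hq : QPinned S P ρ qK) (hA : CandInternal2.HInd3Theta S P ρ) (hmono : LogvolMono P)
    (i : Fin T.lstar) (hi : 1 ≤ (i : ℕ)) (vQ : T.VQ)
    (hθ : (S.D P.n).Adm _ vQ (P.thetaRegion3 (Setting.labelSucc i) vQ))
    (hscaled : (S.D P.n).logvol _ vQ (P.thetaRegion3 (Setting.labelSucc i) vQ) =
      (((i : ℕ) + 1 : ℕ) : ℝ) ^ 2 * P.qLocal (Setting.labelSucc i) vQ)
    (hneg : P.qLocal (Setting.labelSucc i) vQ < 0) :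
    ¬ (ρ qK (Setting.labelSucc i) vQ ⊆ ⋃ m : ℤ, ρ (CandInternal2.shellSat S P.n ((S.col P.n).frobΨ m)) (Setting.labelSucc i) vQ) := fun hB =>
  cell_qRegion_subset_false_of_honest S P hmono i hi vQ hθ hscaled hneg fun x hx => by
    rw [hq] at hx
    obtain ⟨m, hm⟩ := Set.mem_iUnion.1 (hB hx)
    exact Set.mem_iUnion.2 ⟨m, hA m _ vQ hm⟩

/-- **At the label `j = 2` itself** (`i = 1`, `l⋇ ≥ 2`): row 1 keeps exactly this cell, and it is false on the honest bed — cutting the labels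
`j ≥ 3` does not evade the honest ceiling. [folklore] -/
theorem labelTwo_shellOrbit_false_of_honest (hl : 2 ≤ T.lstar) (hq : QPinned S P ρ qK) (hA : CandInternal2.HInd3Theta S P ρ)
    (hmono : LogvolMono P) (vQ : T.VQ)
    (hθ : (S.D P.n).Adm _ vQ (P.thetaRegion3 (Setting.labelSucc ⟨1, hl⟩) vQ))
    (hscaled : (S.D P.n).logvol _ vQ (P.thetaRegion3 (Setting.labelSucc ⟨1, hl⟩) vQ) =
      (((1 : ℕ) + 1 : ℕ) : ℝ) ^ 2 * P.qLocal (Setting.labelSucc ⟨1, hl⟩) vQ)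
    (hneg : P.qLocal (Setting.labelSucc ⟨1, hl⟩) vQ < 0) :
    ¬ (ρ qK (Setting.labelSucc ⟨1, hl⟩) vQ ⊆ ⋃ m : ℤ, ρ (CandInternal2.shellSat S P.n ((S.col P.n).frobΨ m)) (Setting.labelSucc ⟨1, hl⟩) vQ) :=
  cell_shellOrbit_false_of_honest S P ρ qK hq hA hmono ⟨1, hl⟩ le_rfl vQ hθ hscaled hneg

end Region

end Summit.ABC.IUTFork.Repair.RHLabelCutJ2K2

end
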